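import Summits.ResolutionOfSingularities.ResolutionOfSingularities.Theorems.AbsoluteQFrameGeneration
import Literature.AlgebraicGeometry.Resolution.PIndependence
import HarnessLib

/-!
# AbsoluteQFrameField — decomp-res node «AbsoluteContactInsep» (lens-6 g18), tree file 7/10 of the node

Content VERBATIM from the decomp-res lens-6 g18 file `HOME/decomp-res-lens-6/g18/AbsoluteContactInsep.lean` (sha256
3771488be5d3cd2c, 1966 l; HOME =
run/shared/lean/pub/decomp-res).  Critic: CRITIC-LEDGER row 139 (CLEARED 2026-08-30T20:11:48Z, DECIDED +1:
`AbsContactOff3` proved for every p ≠ 3 and every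
field, hypothesis-free); split per the lens's NODE-g18 §8 writer package (sections kept whole; two packages halved
for the 400-line limit).  Landed by
decomp-res writer g7 in the lens's namespace `…Theorems.AbsoluteContactClasses` (cone-free chain); the wiring
`Theorems/MaxContactCutAbsContactOff3`
(`agAbsContactOff3 : AGAbsContactOff3`, item 27752) follows the chain.  No new aside, nothing superseded; asides
31574 / 27753 / 27896 are ⟺ each other
hypothesis-free by this node.

Sections `FieldLayer` + `FieldLayerIndep` (l. 1307–1651; + Literature `PIndependence`).

[WRITER NOTE (decomp-res writer g7): file split only; namespace, opens, section variables and every declaration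
exactly as in the lens (global `set_option` dropped).]

(Sources: Giraud1975; EGA IV 16.11.2, 0_IV 21.9; KimuraNiitsuma1980 Thm 3.4; EncinasVillamayor2000 Thm 4.9;
BravoGarciaEscamillaVillamayor2012 Lemma 4.6; Hironaka1964; CossartJannsenSaito2020; CossartPiltant2019; Kunz1969.)
-/

noncomputable section

open CategoryTheory AlgebraicGeometry TopologicalSpace
open Literature.AlgebraicGeometry.Resolution
open Summit.ResolutionOfSingularities.ResolutionOfSingularities.Theorems
open WeakOrderReduction ForcedTowerClasses PurityValveClasses
open SatelliteExitClasses
open IsLocalRing MvPolynomial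

namespace Summit.ResolutionOfSingularities.ResolutionOfSingularities.Theorems.AbsoluteContactClasses

section FieldLayer

/-! ## Part B — field layer: `p`-bases of the residue field adapted to the coefficient field

Throughout `K` is a field of characteristic `p`, `Kp = K^p` its subfield of `p`-th powers, and
`pcl q T = K^q[T]` the subring generated by the `q`-th powers and `T`. -/

variable {K : Type*} [Field K]

/-- `K^{q}[T]` as a subring. -/
def pcl (q : ℕ) (T : Set K) : Subring K := Subring.closure ((fun y : K => y ^ q) '' Set.univ ∪ T)

/-- `pow_mem_pcl`: Auxiliary step of this node's calculus, VERBATIM from the lens file (see the module docstring);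
the statement is its type. [folklore] -/
theorem pow_mem_pcl (q : ℕ) (T : Set K) (y : K) : y ^ q ∈ pcl q T :=
  Subring.subset_closure (Or.inl ⟨y, Set.mem_univ _, rfl⟩)

/-- `mem_pcl_of_mem`: Auxiliary step of this node's calculus, VERBATIM from the lens file (see the module
docstring); the statement is its type. [folklore] -/
theorem mem_pcl_of_mem {q : ℕ} {T : Set K} {t : K} (ht : t ∈ T) : t ∈ pcl q T :=
  Subring.subset_closure (Or.inr ht)

/-- `inv_mem_pcl`: Auxiliary step of this node's calculus, VERBATIM from the lens file (see the module docstring);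
the statement is its type. [folklore] -/
theorem inv_mem_pcl {q : ℕ} (hq : 0 < q) (T : Set K) {x : K} (hx : x ∈ pcl q T) : x⁻¹ ∈ pcl q T := by
  by_cases hx0 : x = 0
  · rw [hx0, inv_zero]; exact zero_mem _
  have hxq : x ^ q = x * x ^ (q - 1) := by rw [← pow_succ', Nat.sub_add_cancel hq]
  have : x⁻¹ = (x⁻¹) ^ q * x ^ (q - 1) := by
    refine inv_eq_of_mul_eq_one_right ?_
    calc x * ((x⁻¹) ^ q * x ^ (q - 1)) = (x⁻¹) ^ q * x ^ q := by rw [hxq]; ring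
      _ = 1 := by rw [← mul_pow, inv_mul_cancel₀ hx0, one_pow]
  rw [this]
  exact mul_mem (pow_mem_pcl q T _) (pow_mem hx _)

/-- `K^{q}[T]` is a subfield (inverse trick `x⁻¹ = (x⁻¹)^q x^{q-1}`). -/
def pclField {q : ℕ} (hq : 0 < q) (T : Set K) : Subfield K :=
  { pcl q T with inv_mem' := fun _ hx => inv_mem_pcl hq T hx }

/-- `mem_pclField_iff`: Auxiliary step of this node's calculus, VERBATIM from the lens file (see the module
docstring); the statement is its type. [folklore] -/
theorem mem_pclField_iff {q : ℕ} (hq : 0 < q) (T : Set K) (x : K) : x ∈ pclField hq T ↔ x ∈ pcl q T :=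
  Iff.rfl

variable (p : ℕ) [Fact p.Prime] [CharP K p]

/-- `K^p(T) ⊆ K^p[T]` (the latter is already a field). [folklore] -/
theorem mem_pcl_of_mem_adjoin (T : Set K) {x : K}
    (hx : x ∈ IntermediateField.adjoin (↥(frobenius K p).fieldRange) T) : x ∈ pcl p T := by
  have hp : 0 < p := (Fact.out : p.Prime).pos
  have h1 : x ∈ (IntermediateField.adjoin (↥(frobenius K p).fieldRange) T).toSubfield := hx
  rw [IntermediateField.adjoin_toSubfield] at h1
  have h2 : Subfield.closure (Set.range (algebraMap (↥(frobenius K p).fieldRange) K) ∪ T) ≤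
      pclField hp T := by
    rw [Subfield.closure_le]
    rintro y (⟨c, rfl⟩ | hy)
    · obtain ⟨z, hz⟩ := RingHom.mem_fieldRange.mp c.2
      show (c : K) ∈ pcl p T
      rw [← hz, frobenius_def]
      exact pow_mem_pcl p T z
    · exact mem_pcl_of_mem hy
  exact h2 h1

/-- Level change for generation: `K = K^p[T]` implies `K = K^{p^e}[T]` for all `e ≥ 1`. [folklore] -/
theorem forall_mem_pcl_pow (T : Set K) (hT : ∀ x : K, x ∈ pcl p T) :
    ∀ e : ℕ, 0 < e → ∀ x : K, x ∈ pcl (p ^ e) T := by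
  intro e he
  induction e with
  | zero => omega
  | succ e ih =>
    intro x
    rcases Nat.eq_zero_or_pos e with rfl | he'
    · simpa using hT x
    have ih' := ih he'
    have hle : pcl p T ≤ pcl (p ^ (e + 1)) T := by
      show Subring.closure _ ≤ _
      rw [Subring.closure_le]
      rintro y (⟨z, -, rfl⟩ | hy)
      · have hz : z ^ p ∈ (pcl (p ^ e) T).map (frobenius K p) := ⟨z, ih' z, frobenius_def ..⟩
        rw [pcl, RingHom.map_closure] at hz
        refine (Subring.closure_le.mpr ?_) hz
        rintro w ⟨v, (⟨a, -, rfl⟩ | hv), rfl⟩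
        · show frobenius K p (a ^ p ^ e) ∈ pcl (p ^ (e + 1)) T
          rw [frobenius_def, ← pow_mul, ← pow_succ]
          exact pow_mem_pcl _ T a
        · show frobenius K p v ∈ pcl (p ^ (e + 1)) T
          rw [frobenius_def]
          exact pow_mem (mem_pcl_of_mem hv) _
      · exact mem_pcl_of_mem hy
    exact hle (hT x)

open Literature.AlgebraicGeometry.Resolution in
/-- **Zorn**: a `p`-independent `T ⊆ K` with `K = K^p(T)` containing a part `Λ ⊆ k̄` with
`k̄ ⊆ K^p(Λ)` (`Λ` maximal `p`-independent inside the image `k̄` of the coefficient field). [folklore] -/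
theorem exists_adapted_pIndependent (k : Type*) [Field k] [Algebra k K] :
    ∃ Λ T : Set K, Λ ⊆ Set.range (algebraMap k K) ∧ Λ ⊆ T ∧
      IsPIndependent (F := ↥(frobenius K p).fieldRange) p T ∧
      (∀ x : K, x ∈ IntermediateField.adjoin (↥(frobenius K p).fieldRange) T) ∧
      ∀ a : k, algebraMap k K a ∈ IntermediateField.adjoin (↥(frobenius K p).fieldRange) Λ := by
  classical
  have hexp : ∀ x : K, x ^ p ∈ (algebraMap (↥(frobenius K p).fieldRange) K).range := fun x =>
    ⟨⟨x ^ p, RingHom.mem_fieldRange.mpr ⟨x, frobenius_def ..⟩⟩, rfl⟩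
  obtain ⟨Λ, hΛ⟩ := zorn_subset
    {S : Set K | S ⊆ Set.range (algebraMap k K) ∧ IsPIndependent (F := ↥(frobenius K p).fieldRange) p S}
    (fun c hc hchain => ⟨⋃₀ c, ⟨Set.sUnion_subset fun s hs => (hc hs).1,
      isPIndependent_sUnion_of_isChain hchain fun s hs => (hc hs).2⟩,
      fun s hs => Set.subset_sUnion_of_mem hs⟩)
  have hΛk : Λ ⊆ Set.range (algebraMap k K) := hΛ.prop.1
  have hΛi : IsPIndependent (F := ↥(frobenius K p).fieldRange) p Λ := hΛ.prop.2
  obtain ⟨T, hΛT, hT⟩ := zorn_subset_nonempty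
    {S : Set K | IsPIndependent (F := ↥(frobenius K p).fieldRange) p S}
    (fun c hc hchain _ => ⟨⋃₀ c, isPIndependent_sUnion_of_isChain hchain fun s hs => hc hs,
      fun s hs => Set.subset_sUnion_of_mem hs⟩) Λ hΛi
  refine ⟨Λ, T, hΛk, hΛT, hT.prop, fun x => ?_, fun a => ?_⟩
  · by_contra hx
    have hins := isPIndependent_insert hT.prop hx (hexp x)
    have hxT : x ∉ T := fun h => hx (IntermediateField.subset_adjoin _ _ h)
    exact hxT (hT.mem_of_prop_insert hins)
  · by_contra ha
    have hins := isPIndependent_insert hΛi ha (hexp _)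
    have haΛ : algebraMap k K a ∉ Λ := fun h => ha (IntermediateField.subset_adjoin _ _ h)
    exact haΛ (hΛ.mem_of_prop_insert ⟨Set.insert_subset ⟨a, rfl⟩ hΛk, hins⟩)

end FieldLayer

section FieldLayerIndep

/-! ### Linear independence of the reduced monomials in a `p`-independent set, and digits -/

variable {K : Type*} [Field K] (p : ℕ) [Fact p.Prime] [CharP K p]

/-- General closure lemma over an algebra: if the generators `G` multiply `M` into the `P`-span
of `M`, so does the subring they generate. [folklore] -/
theorem closure_mul_span_le' {P A : Type*} [CommRing P] [CommRing A] [Algebra P A] (G M : Set A)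
    (hG : ∀ g ∈ G, ∀ m ∈ M, g * m ∈ Submodule.span P M) :
    ∀ x ∈ Subring.closure G, ∀ w ∈ Submodule.span P M, x * w ∈ Submodule.span P M := by
  intro x hx
  let N : Subring A :=
    { carrier := {x | ∀ w ∈ Submodule.span P M, x * w ∈ Submodule.span P M}
      mul_mem' := fun {x y} hx hy w hw => by rw [mul_assoc]; exact hx _ (hy w hw)
      one_mem' := fun w hw => by rwa [one_mul]
      add_mem' := fun {x y} hx hy w hw => by rw [add_mul]; exact add_mem (hx w hw) (hy w hw)
      zero_mem' := fun w _ => by rw [zero_mul]; exact zero_mem _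
      neg_mem' := fun {x} hx w hw => by rw [neg_mul]; exact neg_mem (hx w hw) }
  have hGN : G ⊆ (N : Set A) := fun g hg w hw => by
    induction hw using Submodule.span_induction with
    | mem m hm => exact hG g hg m hm
    | zero => rw [mul_zero]; exact zero_mem _
    | add _ _ _ _ h₁ h₂ => rw [mul_add]; exact add_mem h₁ h₂
    | smul c w _ h => rw [mul_smul_comm]; exact Submodule.smul_mem _ c h
  exact Subring.closure_le.mpr hGN hx

/-- the reduced monomials in a finite set `t`. -/
def pMon (t : Finset K) (f : ↥t → Fin p) : K := ∏ x : ↥t, (x : K) ^ (f x : ℕ)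

omit [CharP K p] in
/-- `pMon_mul`: Auxiliary step of this node's calculus, VERBATIM from the lens file (see the module docstring); the
statement is its type. [folklore] -/
theorem pMon_mul (t : Finset K) (f g : ↥t → Fin p) :
    pMon p t f * pMon p t g = (∏ x : ↥t, (x : K) ^ (((f x : ℕ) + g x) / p)) ^ p *
      pMon p t (fun x => ⟨((f x : ℕ) + g x) % p, Nat.mod_lt _ (Fact.out : p.Prime).pos⟩) := by
  rw [pMon, pMon, pMon, ← Finset.prod_pow, ← Finset.prod_mul_distrib, ← Finset.prod_mul_distrib]
  exact Finset.prod_congr rfl fun x _ => by rw [← pow_mul', ← pow_add, ← pow_add, Nat.div_add_mod]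

open Literature.AlgebraicGeometry.Resolution in
/-- **The `p^{#t}` reduced monomials of a finite part of a `p`-independent set are linearly
independent over `K^p`** (they span `K^p(t)`, which has degree `p^{#t}`). [folklore] -/
theorem linearIndependent_pMon {T : Set K}
    (hT : IsPIndependent (F := ↥(frobenius K p).fieldRange) p T) (t : Finset K) (ht : (t : Set K) ⊆ T) :
    LinearIndependent (↥(frobenius K p).fieldRange) (pMon p t) := by
  classical
  have hp : p.Prime := Fact.out
  set F := (frobenius K p).fieldRange with hFdef
  -- the span of the monomials is closed under multiplication and contains `t` and `1`
  let W : Submodule (↥F) K := Submodule.span (↥F) (Set.range (pMon p t))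
  have hWmul : ∀ x y : K, x ∈ W → y ∈ W → x * y ∈ W := by
    intro x y hx hy
    have hle : W * W ≤ W := by
      rw [Submodule.span_mul_span, Submodule.span_le]
      rintro _ ⟨_, ⟨f, rfl⟩, _, ⟨g, rfl⟩, rfl⟩
      show pMon p t f * pMon p t g ∈ W
      rw [pMon_mul]
      have : (∏ x : ↥t, (x : K) ^ (((f x : ℕ) + g x) / p)) ^ p ∈ F :=
        RingHom.mem_fieldRange.mpr ⟨_, frobenius_def ..⟩
      exact Submodule.smul_mem W ⟨_, this⟩ (Submodule.subset_span ⟨_, rfl⟩)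
    exact hle (Submodule.mul_mem_mul hx hy)
  have hW1 : (1 : K) ∈ W := Submodule.subset_span ⟨fun _ => ⟨0, hp.pos⟩, by simp [pMon]⟩
  have hWt : (t : Set K) ⊆ W := fun x hx => by
    refine Submodule.subset_span ⟨fun y => if (y : K) = x then ⟨1, hp.one_lt⟩ else ⟨0, hp.pos⟩, ?_⟩
    show pMon p t _ = x
    rw [pMon, Finset.prod_eq_single_of_mem (⟨x, Finset.mem_coe.mp hx⟩ : ↥t) (Finset.mem_univ _)]
    · simp
    · intro y _ hy
      have : (y : K) ≠ x := fun h => hy (Subtype.ext h)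
      simp [this]
  -- `K^p(t) = W` as `K^p`-submodules
  have halg : ∀ x ∈ (t : Set K), IsAlgebraic (↥F) x := fun x _ => by
    refine (IsIntegral.of_pow hp.pos ?_).isAlgebraic
    exact (isIntegral_algebraMap (x := (⟨x ^ p, RingHom.mem_fieldRange.mpr ⟨x, frobenius_def ..⟩⟩ : ↥F)))
  have heq : Subalgebra.toSubmodule (IntermediateField.adjoin (↥F) (t : Set K)).toSubalgebra = W := by
    refine le_antisymm ?_ ?_
    · rw [IntermediateField.adjoin_toSubalgebra_of_isAlgebraic halg]
      have := Algebra.adjoin_le (S := W.toSubalgebra hW1 hWmul) hWt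
      intro x hx
      exact (Submodule.mem_toSubalgebra (p := W)).mp (this hx)
    · rw [Submodule.span_le]
      rintro _ ⟨f, rfl⟩
      rw [SetLike.mem_coe, Subalgebra.mem_toSubmodule, IntermediateField.mem_toSubalgebra, pMon]
      exact prod_mem fun x _ =>
        pow_mem (IntermediateField.subset_adjoin (↥F) (t : Set K) (Finset.mem_coe.mpr x.2)) _
  -- count dimensions
  rw [linearIndependent_iff_card_eq_finrank_span, Set.finrank]
  change Fintype.card (↥t → Fin p) = Module.finrank (↥F) W
  rw [← heq, Subalgebra.finrank_toSubmodule, IntermediateField.finrank_eq_finrank_subalgebra, hT t ht,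
    Fintype.card_fun, Fintype.card_fin, Fintype.card_coe]

open Literature.AlgebraicGeometry.Resolution in
/-- `p`-independence in the linear (Kunz) form for the inclusion `T ↪ K`. [folklore] -/
theorem qIndep_of_isPIndependent {T : Set K}
    (hT : IsPIndependent (F := ↥(frobenius K p).fieldRange) p T) : QIndep p (Subtype.val : T → K) := by
  classical
  have hp : p.Prime := Fact.out
  intro s c hs hsum μ₀ hμ₀
  -- the finitely many elements of `T` in play
  let tT : Finset ↥T := s.biUnion Finsupp.support
  let t : Finset K := tT.image Subtype.val
  have ht : (t : Set K) ⊆ T := by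
    intro x hx
    obtain ⟨i, -, rfl⟩ := Finset.mem_image.mp (Finset.mem_coe.mp hx)
    exact i.2
  have hsupp : ∀ μ ∈ s, μ.support ⊆ tT := fun μ hμ => Finset.subset_biUnion_of_mem Finsupp.support hμ
  -- exponent functions
  let ex : (↥T →₀ ℕ) → K → ℕ := fun μ y => if h : y ∈ T then μ ⟨y, h⟩ else 0
  have hex : ∀ μ (i : ↥T), ex μ i = μ i := fun μ i => by simp [ex, i.2]
  let fμ : (↥T →₀ ℕ) → (↥t → Fin p) := fun μ x => ⟨ex μ x % p, Nat.mod_lt _ hp.pos⟩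
  have hfμ : ∀ μ ∈ s, ∀ x : ↥t, (fμ μ x : ℕ) = ex μ x := fun μ hμ x => by
    obtain ⟨i, -, hi⟩ := Finset.mem_image.mp x.2
    simp only [fμ]
    rw [← hi, hex, Nat.mod_eq_of_lt (hs μ hμ i)]
  -- the monomials agree
  have hmon : ∀ μ ∈ s, μ.prod (fun (i : ↥T) (k : ℕ) => (i : K) ^ k) = pMon p t (fμ μ) := by
    intro μ hμ
    rw [pMon, Finsupp.prod_of_support_subset μ (hsupp μ hμ) _ (fun _ _ => pow_zero _)]
    have h1 : ∏ x : ↥t, (x : K) ^ (fμ μ x : ℕ) = ∏ y ∈ t, y ^ ex μ y := by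
      rw [← Finset.prod_coe_sort t]
      exact Finset.prod_congr rfl fun x _ => by rw [hfμ μ hμ x]
    rw [h1, Finset.prod_image fun i _ j _ h => Subtype.ext h]
    exact Finset.prod_congr rfl fun i _ => by rw [hex]
  -- injectivity of `μ ↦ fμ μ` on `s`
  have hinj : ∀ μ ∈ s, ∀ ν ∈ s, fμ μ = fμ ν → μ = ν := by
    intro μ hμ ν hν h
    ext i
    by_cases hi : i ∈ tT
    · have hx : (i : K) ∈ t := Finset.mem_image_of_mem Subtype.val hi
      have h' : (fμ μ ⟨(i : K), hx⟩ : ℕ) = (fμ ν ⟨(i : K), hx⟩ : ℕ) := by rw [h]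
      rwa [hfμ μ hμ, hfμ ν hν, hex, hex] at h'
    · have h1 : i ∉ μ.support := fun h' => hi (hsupp μ hμ h')
      have h2 : i ∉ ν.support := fun h' => hi (hsupp ν hν h')
      rw [Finsupp.notMem_support_iff.mp h1, Finsupp.notMem_support_iff.mp h2]
  -- apply linear independence over `K^p`
  have hLI := (linIndepOver_iff _ _).mpr (linearIndependent_pMon p hT t ht)
  let c' : (↥t → Fin p) → K := fun f => ∑ μ ∈ s.filter (fun μ => fμ μ = f), c μ ^ p
  have hc' : ∀ f, c' f ∈ (frobenius K p).fieldRange := fun f =>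
    Subfield.sum_mem _ fun μ _ => RingHom.mem_fieldRange.mpr ⟨c μ, frobenius_def ..⟩
  have hsum' : ∑ f, c' f * pMon p t f = 0 := by
    rw [← hsum]
    simp only [c', Finset.sum_mul]
    rw [← Finset.sum_fiberwise s fμ (fun μ => c μ ^ p * μ.prod fun (i : ↥T) (k : ℕ) => (i : K) ^ k)]
    refine Finset.sum_congr rfl fun f _ => Finset.sum_congr rfl fun μ hμ => ?_
    obtain ⟨hμs, hμf⟩ := Finset.mem_filter.mp hμ
    rw [hmon μ hμs, hμf]
  have hzero := hLI c' hc' hsum' (fμ μ₀)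
  have : c' (fμ μ₀) = c μ₀ ^ p := by
    simp only [c']
    rw [Finset.sum_eq_single_of_mem μ₀
      (Finset.mem_filter.mpr ⟨hμ₀, rfl⟩ : μ₀ ∈ s.filter (fun μ => fμ μ = fμ μ₀))]
    intro ν hν hne
    exact absurd (hinj ν (Finset.mem_filter.mp hν).1 μ₀ hμ₀ (Finset.mem_filter.mp hν).2) hne
  rw [this] at hzero
  exact pow_eq_zero_iff (hp.ne_zero) |>.mp hzero

omit [CharP K p] in
/-- digits: `p`-independence in the linear form implies `p^e`-independence. [folklore] -/
theorem QIndep.pow_level [CharP K p] {ι : Type*} {v : ι → K} (h : QIndep p v) : ∀ e : ℕ, QIndep (p ^ e) v := by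
  classical
  have hp : p.Prime := Fact.out
  have frob_sum : ∀ (s : Finset (ι →₀ ℕ)) (f : (ι →₀ ℕ) → K), (∑ x ∈ s, f x) ^ p = ∑ x ∈ s, f x ^ p :=
    fun s f => by simpa only [frobenius_def] using map_sum (frobenius K p) f s
  let g : ι → ℕ → K := fun i k => v i ^ k
  intro e
  induction e with
  | zero =>
    intro s c hs hsum μ hμ
    have hμ0 : ∀ ν ∈ s, ν = 0 := fun ν hν => Finsupp.ext fun i => by
      have := hs ν hν i; rw [pow_zero] at this; simp only [Finsupp.coe_zero, Pi.zero_apply]; omega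
    have hs0 : s = {0} := Finset.eq_singleton_iff_unique_mem.mpr ⟨hμ0 μ hμ ▸ hμ, hμ0⟩
    rw [hs0, Finset.sum_singleton, pow_zero, pow_one, Finsupp.prod_zero_index, mul_one] at hsum
    rw [hμ0 μ hμ]; exact hsum
  | succ e ih =>
    intro s c hs hsum
    let lo : (ι →₀ ℕ) → (ι →₀ ℕ) := fun μ => μ.mapRange (· % p) (Nat.zero_mod p)
    let hi : (ι →₀ ℕ) → (ι →₀ ℕ) := fun μ => μ.mapRange (· / p) (Nat.zero_div p)
    have hrec : ∀ μ, lo μ + p • hi μ = μ := fun μ => Finsupp.ext fun i => by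
      simp only [lo, hi, Finsupp.coe_add, Pi.add_apply, Finsupp.mapRange_apply, Finsupp.coe_smul,
        Pi.smul_apply, smul_eq_mul]
      exact Nat.mod_add_div _ _
    have hvMon : ∀ μ : ι →₀ ℕ, μ.prod g = (hi μ).prod g ^ p * (lo μ).prod g := by
      intro μ
      rw [Finsupp.prod_of_support_subset (hi μ) Finsupp.support_mapRange g (fun _ _ => pow_zero _),
        Finsupp.prod_of_support_subset (lo μ) Finsupp.support_mapRange g (fun _ _ => pow_zero _),
        Finsupp.prod, ← Finset.prod_pow, ← Finset.prod_mul_distrib]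
      exact Finset.prod_congr rfl fun i _ => by
        simp only [g, hi, lo, Finsupp.mapRange_apply]
        rw [← pow_mul', ← pow_add, Nat.div_add_mod]
    have hlo : ∀ μ₀ ∈ s.image lo, ∀ i, μ₀ i < p := by
      intro μ₀ hμ₀ i
      obtain ⟨μ, -, rfl⟩ := Finset.mem_image.mp hμ₀
      simp only [lo, Finsupp.mapRange_apply]
      exact Nat.mod_lt _ hp.pos
    have hsum1 : ∑ μ₀ ∈ s.image lo,
        (∑ μ ∈ s.filter (fun μ => lo μ = μ₀), c μ ^ p ^ e * (hi μ).prod g) ^ p * μ₀.prod g = 0 := by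
      rw [← hsum]
      symm
      rw [← Finset.sum_fiberwise_of_maps_to (s := s) (t := s.image lo) (g := lo)
        (fun μ hμ => Finset.mem_image_of_mem lo hμ)]
      refine Finset.sum_congr rfl fun μ₀ _ => ?_
      rw [frob_sum, Finset.sum_mul]
      refine Finset.sum_congr rfl fun μ hμ => ?_
      have hμ₀ : lo μ = μ₀ := (Finset.mem_filter.mp hμ).2
      rw [mul_pow, ← pow_mul, ← pow_succ, hvMon μ, hμ₀]
      ring
    have h1 := h (s.image lo) _ hlo hsum1
    intro μ hμ
    have hinner := h1 (lo μ) (Finset.mem_image_of_mem lo hμ)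
    have hhi : ∀ ν' ∈ (s.filter (fun ν => lo ν = lo μ)).image hi, ∀ i, ν' i < p ^ e := by
      intro ν' hν' i
      obtain ⟨ν, hν, rfl⟩ := Finset.mem_image.mp hν'
      simp only [hi, Finsupp.mapRange_apply]
      have := hs ν (Finset.mem_filter.mp hν).1 i
      rw [pow_succ] at this
      exact (Nat.div_lt_iff_lt_mul hp.pos).mpr this
    have hinj : ∀ ν₁ ∈ s.filter (fun ν => lo ν = lo μ), ∀ ν₂ ∈ s.filter (fun ν => lo ν = lo μ),
        hi ν₁ = hi ν₂ → ν₁ = ν₂ := by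
      intro ν₁ h₁ ν₂ h₂ heq
      rw [← hrec ν₁, ← hrec ν₂, heq, (Finset.mem_filter.mp h₁).2, (Finset.mem_filter.mp h₂).2]
    have hsum2 : ∑ ν' ∈ (s.filter (fun ν => lo ν = lo μ)).image hi,
        c (lo μ + p • ν') ^ p ^ e * ν'.prod g = 0 := by
      rw [Finset.sum_image hinj, ← hinner]
      refine Finset.sum_congr rfl fun ν hν => ?_
      rw [← (Finset.mem_filter.mp hν).2, hrec ν]
    have := ih _ (fun ν' => c (lo μ + p • ν')) hhi hsum2 (hi μ)
      (Finset.mem_image_of_mem hi (Finset.mem_filter.mpr ⟨hμ, rfl⟩))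
    rwa [hrec μ] at this

end FieldLayerIndep

end Summit.ResolutionOfSingularities.ResolutionOfSingularities.Theorems.AbsoluteContactClasses
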